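import Summits.BirchSwinnertonDyer.BirchSwinnertonDyer.Theorems.CMKolyvaginAtInertTwoEvaluationSurjectiveAtTwo
import Literature.NumberTheory.EllipticCurves.HeegnerPointsKolyvaginPrimaryPairingProofs
import HarnessLib

/-!
# Route `CMKolyvaginAtInertTwo`, crux `CMKolyvaginExactAtInertTwo` (stmt-BirchSwinnertonDyer-24277):
# GROSS'S PROP. 9.1 AND McCALLUM'S (2) AT `p = 2`, LEVEL `2^M` — restriction
# `H¹(K, E[2^M]) → Hom(Γ_{K(E[2^M])}, E[2^M])` is injective, and the evaluations of independent
# classes are jointly surjective, from a "Cartan-type" element of order-`3` type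

Seat `bsd-line-cmk2-p1` g7 (cell `bsd-print-cf2`); helper (`--supports stmt-BirchSwinnertonDyer-24277`).
THEOREMS ONLY: no definition, no named fact, no `sorry`; no item is closed; BSD is not proved by this.

WHY. The kernel Kolyvagin machine at level `p^M` starts from the injectivity of restriction
`H¹(K, E_{p^M}) ↪ Hom(Γ_{K(E_{p^M})}, E_{p^M})` (McCallum 1991, §3 (2); Gross 1991, Prop. 9.1) and
the joint surjectivity of the evaluations at independent classes (McCallum's (2),
`Literature…exists_h1Eval_eq_of_indep`). At odd `p` both rest on the homothety `−1 ∈ ρ̄_{E,p}(Γ_K)`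
lifted to `E_{p^M}` (`smul_eq_neg_geomTorsion_pow`), which is EMPTY at `p = 2`. Seat g3 replaced it at
LEVEL `2` by the element of order `3` of `GL₂(𝔽₂)` (`h1_restriction_injective_two`, p595478;
`exists_h1Eval_eq_two`, p597299). This file does LEVEL `2^M`, the missing global input of every
`M ≥ 2` statement at `2` (KERNEL-STATUS-p2-port.md §3 item 5, §5b: "what remains … is GLOBAL"):

* `eq_zero_of_h1Eval_eq_zero_of_three_of_comm` (§1, any field, any level `n`): if `z ∈ Γ_K` acts on
  `E[n]` without non-zero fixed points and every conjugate `g⁻¹zg` acts on `E[n]` as `zπ` or `z²π`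
  for some `π ∈ Γ_K` COMMUTING with `z` on `E[n]`, then a class vanishing on `Γ_{K(E[n])}` is `0`
  (g3's `eq_zero_of_h1Eval_eq_zero_of_three` is the case `π = 1`). Cocycle proof: after a coboundary
  the cocycle `ψ` vanishes at `z`; `ψ(zπ) = zψ(π)` and `ψ(zπ) = ψ(πz·ν) = ψ(π)` (`ν ∈ Γ_{K(E[n])}`)
  give `ψ(π) = 0`; then `ψ(g⁻¹zg) = 0` and `zψ(g) = ψ(g)` as at level `2`.
* `smul_fixed_eq_zero_two_pow` (§2): no non-zero fixed point on `E[2]` ⟹ none on `E[2^M]`.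
* `eq_zero_of_h1Eval_eq_zero_two_pow_of_comm` (§2, any field with `#E[2] = 4`), and for `W/ℚ`,
  `[K:ℚ] = 2`, `ρ̄_{W,2}` onto: **`h1_restriction_injective_two_pow`** — GIVEN `z ∈ Γ_K` without
  non-zero fixed point on `E[2]` which COMMUTES ON `E[2^M]` WITH EVERY ELEMENT OF `Γ_{K(E[2])}`
  (hypothesis `hcomm`), restriction `H¹(K, E[2^M]) → Hom(Γ_{K(E[2^M])}, E[2^M])` is injective. The
  conjugates are automatic: mod `E[2]` they are `z^{±1}` (`#E[2] = 4`, g3's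
  `eq_or_eq_sq_of_fixedPointFree`), and the correction `π ∈ Γ_{K(E[2])}` commutes with `z` by `hcomm`.
* **`exists_h1Eval_eq_two_pow`** (§3) — McCALLUM'S (2) AT `p = 2`, LEVEL `2^M`: for `W/ℚ` with
  `ρ̄_{W,2}` onto, `[K:ℚ] = 2`, `Δ_W ∉ K²` (so `E[2]` is simple with scalar commutant over `Γ_K`,
  g3 p595851/p596346) and `hcomm`: classes `x_i ∈ H¹(K, E[2^M])` killed by `2^{e_i}` and independent
  (`∑ a_i x_i = 0 ⟹ 2^{e_i} ∣ a_i`) have jointly surjective evaluations onto `∏ E[2^M][2^{e_i}]` on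
  `Γ_{K(E[2^M])}` — the tree's `KolyvaginPairing.eq_piTors_of_stable_of_indep` (any prime) fed with
  the level-`2^M` injectivity above instead of the odd-`p` homothety.

THE HYPOTHESIS `hcomm` (honest framing). It says: the image of `Γ_{K(E[2])}` in `Aut E[2^M]`
centralises an element of order-`3` type. It HOLDS on the habitat H₂ of the route (CM by `O ∋ ω`
with `2` inert, `ρ̄₂` onto): `Γ_F` (`F = ℚ(√Δ_E)` the CM field) acts on `E[2^∞]` through the abelian
group `(O ⊗ ℤ₂)ˣ` (Lang, *Elliptic Functions*, Ch. 10 §4 Remark + Thm. 8; `T₂E` free of rank one over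
`ℤ₂[ω]`), `Γ_{K(E[2])} ⊆ Γ_F`, and any `z ∈ Γ_K` acting on `E[2]` as a `3`-cycle lies in `Γ_F`; it
also holds whenever the mod-`2^M` image of `Γ_K` lies in the normaliser of a non-split Cartan with
`Γ_{K(E[2])}` inside the Cartan. That CM input is NOT in the tree at `2`-power level (the fact
`cmTorsion_cartanImage` is `ℓ > L₀`, statement-only), so `hcomm` is carried as an explicit
hypothesis by every consumer (the Čebotarev leaf at level `2^M` and the `(−ε)`-part descent of
this seat), exactly as the machine's binders `hpoints` / `hRT` are. For a non-CM curve with large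
`2`-adic image `hcomm` can fail and `H¹(Gal(K(E[2^M])/K), E[2^M])` need not be reached this way.

References: [GrossLMS1991] §9 Props. 9.1, 9.3; [McCallumLMS1991] §3 (2); [LawsonWuthrich2016]
Lemma 6; [Sah1968] Prop. 2.7 (b) (the commuting-element mechanism); [Lang1987] Ch. 10 §4.
-/

-- single-conjunct summit: `Summit.BirchSwinnertonDyer.BirchSwinnertonDyer.…` repeats the name by design
set_option linter.dupNamespace false
set_option autoImplicit false

noncomputable section

open scoped Classical

namespace Summit.BirchSwinnertonDyer.BirchSwinnertonDyer.Theorems.KolyvaginImageTwo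

open WeierstrassCurve Field
open Literature.NumberTheory.EllipticCurves Literature.NumberTheory.GaloisRepresentations

universe u

/-! ## §1 Prop. 9.1 from an element without fixed points whose conjugates are its powers up to a
commuting correction -/

section Cohomology

variable {K : Type u} [Field K] (W : WeierstrassCurve K) (n : ℤ)

/-- **Injectivity of restriction `H¹(K, E[n]) → Hom(Γ_{K(E[n])}, E[n])` from an element of
order-`3` type, with commuting corrections.** If `z ∈ Γ_K` acts on the finite module `E[n]`
without non-zero fixed points and for every `g ∈ Γ_K` there is `π ∈ Γ_K` commuting with `z` on
`E[n]` such that `g⁻¹zg` acts on `E[n]` as `zπ` or as `z²π`, then a class `x ∈ H¹(K, E[n])` with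
`[x, ρ] = 0` for all `ρ ∈ Γ_{K(E[n])}` vanishes (Sah's mechanism for the commuting `π`, then
g3's `eq_zero_of_h1Eval_eq_zero_of_three`, which is the case `π = 1`).
[cite: GrossLMS1991, §9 Prop. 9.1] [cite: Sah1968, Prop. 2.7 (b)] [cite: LawsonWuthrich2016, Lemma 6] -/
theorem eq_zero_of_h1Eval_eq_zero_of_three_of_comm [Finite (geomTorsion W n)]
    {z : absoluteGaloisGroup K} (hzfix : ∀ P : geomTorsion W n, z • P = P → P = 0)
    (hconj : ∀ g : absoluteGaloisGroup K, ∃ π : absoluteGaloisGroup K,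
      (∀ P : geomTorsion W n, π • z • P = z • π • P) ∧
      ((∀ P : geomTorsion W n, (g⁻¹ * z * g) • P = z • π • P) ∨
       (∀ P : geomTorsion W n, (g⁻¹ * z * g) • P = z • z • π • P)))
    {x : galH1Torsion W n} (hx : ∀ ρ ∈ torsionFixing W n, h1Eval W n x ρ = 0) : x = 0 := by
  rw [← oneCocycleClass_reprCocycle W n x]
  set φ := reprCocycle W n x with hφ
  have hφN : ∀ ρ ∈ torsionFixing W n, φ.1 ρ = 0 := hx
  -- `P ↦ z • P - P` is a bijection of the finite set `E[n]`
  have hinj : Function.Injective (fun P : geomTorsion W n ↦ z • P - P) := by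
    intro P Q h
    have h' : z • (P - Q) = P - Q := by
      rw [smul_sub]
      have e : z • P - z • Q - (P - Q) = (z • P - P) - (z • Q - Q) := by abel
      rw [← sub_eq_zero, e, sub_eq_zero]
      exact h
    exact sub_eq_zero.mp (hzfix _ h')
  obtain ⟨b, hb⟩ := Finite.surjective_of_injective hinj (φ.1 z)
  -- `hb : z • b - b = φ z`; we show `φ = ∂b`
  refine (oneCocycleClass_eq_zero_iff _ φ).mpr ⟨b, fun g ↦ ?_⟩
  rw [discreteTopRep_ρ_apply]
  set ψ : absoluteGaloisGroup K → geomTorsion W n := fun g ↦ φ.1 g - (g • b - b) with hψ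
  have hcoc : ∀ g h : absoluteGaloisGroup K, ψ (g * h) = ψ g + g • ψ h := by
    intro g h
    have hgh := φ.2 g h
    rw [discreteTopRep_ρ_apply] at hgh
    simp only [hψ, hgh, mul_smul, smul_sub]
    abel
  have hψz : ψ z = 0 := by
    simp only [hψ, ← hb, sub_self]
  have hψN : ∀ ρ ∈ torsionFixing W n, ψ ρ = 0 := fun ρ hρ ↦ by
    simp only [hψ, hφN ρ hρ, smul_eq_of_mem_torsionFixing W n hρ, sub_self]
  have hψzz : ψ (z * z) = 0 := by rw [hcoc, hψz, smul_zero, add_zero]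
  -- Sah's mechanism: `ψ` vanishes at every `π` commuting with `z` on `E[n]`
  have hψπ : ∀ π : absoluteGaloisGroup K, (∀ P : geomTorsion W n, π • z • P = z • π • P) →
      ψ π = 0 := by
    intro π hπ
    have hν : (π * z)⁻¹ * (z * π) ∈ torsionFixing W n :=
      (mem_torsionFixing_iff W n).mpr fun P ↦ by
        rw [mul_smul, mul_smul z π P, ← hπ P, ← mul_smul π z P, inv_smul_smul]
    have h1 : ψ (z * π) = z • ψ π := by rw [hcoc, hψz, zero_add]
    have h2 : ψ (z * π) = ψ π := by
      have h3 : ψ ((π * z) * ((π * z)⁻¹ * (z * π))) = ψ π := by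
        rw [hcoc, hψN _ hν, smul_zero, add_zero, hcoc, hψz, smul_zero, add_zero]
      rwa [show (π * z) * ((π * z)⁻¹ * (z * π)) = z * π by group] at h3
    have h4 : z • ψ π = ψ π := by rw [← h1, h2]
    exact hzfix _ h4
  suffices hall : ∀ g, ψ g = 0 by
    have := hall g
    simp only [hψ] at this
    exact sub_eq_zero.mp this
  intro g
  -- the conjugate `z' = g⁻¹ z g` is `z · π · n₀` or `z² · π · n₀` with `n₀ ∈ Γ_{K(E[n])}`
  obtain ⟨π, hπ, hcase⟩ := hconj g
  have hψz' : ψ (g⁻¹ * z * g) = 0 := by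
    rcases hcase with h | h
    · have hn₀ : (z * π)⁻¹ * (g⁻¹ * z * g) ∈ torsionFixing W n :=
        (mem_torsionFixing_iff W n).mpr fun P ↦ by rw [mul_smul, h P, ← mul_smul z π P, inv_smul_smul]
      have e : g⁻¹ * z * g = (z * π) * ((z * π)⁻¹ * (g⁻¹ * z * g)) := by group
      rw [e, hcoc, hψN _ hn₀, smul_zero, add_zero, hcoc, hψz, zero_add, hψπ π hπ, smul_zero]
    · have hn₀ : (z * z * π)⁻¹ * (g⁻¹ * z * g) ∈ torsionFixing W n :=
        (mem_torsionFixing_iff W n).mpr fun P ↦ by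
          rw [mul_smul, h P, ← mul_smul z π P, ← mul_smul z (z * π) P, ← mul_assoc, inv_smul_smul]
      have e : g⁻¹ * z * g = (z * z * π) * ((z * z * π)⁻¹ * (g⁻¹ * z * g)) := by group
      rw [e, hcoc, hψN _ hn₀, smul_zero, add_zero, hcoc, hψzz, zero_add, hψπ π hπ, smul_zero]
  have h1 : ψ (z * g) = z • ψ g := by rw [hcoc, hψz, zero_add]
  have h2 : ψ (g * (g⁻¹ * z * g)) = ψ g := by rw [hcoc, hψz', smul_zero, add_zero]
  have h3 : g * (g⁻¹ * z * g) = z * g := by group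
  rw [h3, h1] at h2
  exact hzfix _ h2

/-! ## §2 Level `2^M`: fixed points, and the conjugates from `#E[2] = 4` and `hcomm` -/

/-- **No non-zero fixed point on `E[2]` ⟹ none on `E[2^M]`**: if `z • P = P` with `P ∈ E[2^M]`,
then `2P ∈ E[2^{M-1}]` is fixed, so `2P = 0` by induction, so `P ∈ E[2]` is fixed, so `P = 0`. [folklore] -/
theorem smul_fixed_eq_zero_two_pow {z : absoluteGaloisGroup K}
    (hz : ∀ P : geomTorsion W ((2 : ℕ) : ℤ), z • P = P → P = 0) (M : ℕ)
    (P : geomTorsion W ((2 ^ M : ℕ) : ℤ)) (hP : z • P = P) : P = 0 := by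
  induction M with
  | zero =>
    have h := (mem_geomTorsion_iff W _ (P : geomPoints W)).mp P.2
    simp only [pow_zero, Nat.cast_one, one_smul] at h
    exact Subtype.ext h
  | succ M ih =>
    have hPc : z • (P : geomPoints W) = P := by
      rw [← AddSubgroup.torsionBy.coe_smul, hP]
    -- `Q = 2 • P ∈ E[2^M]` is fixed by `z`
    have hQmem : (2 : ℤ) • (P : geomPoints W) ∈ geomTorsion W ((2 ^ M : ℕ) : ℤ) := by
      rw [mem_geomTorsion_iff, smul_smul]
      have h := (mem_geomTorsion_iff W _ (P : geomPoints W)).mp P.2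
      have e : (((2 ^ M : ℕ) : ℤ)) * 2 = ((2 ^ (M + 1) : ℕ) : ℤ) := by push_cast; ring
      rw [e]; exact h
    have hzQ : z • ((2 : ℤ) • (P : geomPoints W)) = (2 : ℤ) • (z • (P : geomPoints W)) :=
      map_zsmul (DistribSMul.toAddMonoidHom (geomPoints W) z) 2 _
    have hQ0 : (⟨(2 : ℤ) • (P : geomPoints W), hQmem⟩ : geomTorsion W ((2 ^ M : ℕ) : ℤ)) = 0 :=
      ih _ (Subtype.ext (by
        change z • ((2 : ℤ) • (P : geomPoints W)) = (2 : ℤ) • (P : geomPoints W)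
        rw [hzQ, hPc]))
    have h2P : (2 : ℤ) • (P : geomPoints W) = 0 := congrArg Subtype.val hQ0
    -- so `P ∈ E[2]`, fixed, hence `0`
    have hPmem : (P : geomPoints W) ∈ geomTorsion W ((2 : ℕ) : ℤ) := by
      rw [mem_geomTorsion_iff]; exact_mod_cast h2P
    have hP'0 : (⟨(P : geomPoints W), hPmem⟩ : geomTorsion W ((2 : ℕ) : ℤ)) = 0 :=
      hz _ (Subtype.ext hPc)
    have hval : (P : geomPoints W) = 0 := congrArg Subtype.val hP'0
    exact Subtype.ext hval

/-- **Prop. 9.1 at level `2^M` from a commuting element of order-`3` type (any field with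
`#E[2] = 4`).** If `z ∈ Γ_K` has no non-zero fixed point on `E[2]` and commutes on `E[2^M]` with
every element of `Γ_{K(E[2])}`, then a class `x ∈ H¹(K, E[2^M])` vanishing on `Γ_{K(E[2^M])}` is
`0`: every conjugate `g⁻¹zg` acts on `E[2]` without fixed points, hence as `z` or `z²` there
(`eq_or_eq_sq_of_fixedPointFree`), i.e. `g⁻¹zg = z^{1,2}·π` with `π ∈ Γ_{K(E[2])}`, and §1 applies.
[cite: GrossLMS1991, §9 Prop. 9.1] [cite: LawsonWuthrich2016, Lemma 6] [cite: Sah1968, Prop. 2.7 (b)] -/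
theorem eq_zero_of_h1Eval_eq_zero_two_pow_of_comm {M : ℕ}
    [Finite (geomTorsion W ((2 ^ M : ℕ) : ℤ))]
    (hcard : Nat.card (geomTorsion W ((2 : ℕ) : ℤ)) = 4)
    {z : absoluteGaloisGroup K} (hzfix : ∀ P : geomTorsion W ((2 : ℕ) : ℤ), z • P = P → P = 0)
    (hcomm : ∀ π ∈ torsionFixing W ((2 : ℕ) : ℤ), ∀ P : geomTorsion W ((2 ^ M : ℕ) : ℤ),
      π • z • P = z • π • P)
    {x : galH1Torsion W ((2 ^ M : ℕ) : ℤ)}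
    (hx : ∀ ρ ∈ torsionFixing W ((2 ^ M : ℕ) : ℤ), h1Eval W ((2 ^ M : ℕ) : ℤ) x ρ = 0) : x = 0 := by
  haveI : Finite (geomTorsion W ((2 : ℕ) : ℤ)) := Nat.finite_of_card_ne_zero (by rw [hcard]; norm_num)
  have h2 : ∀ t : geomTorsion W ((2 : ℕ) : ℤ), t + t = 0 := fun t ↦ by
    have := AddSubgroup.torsionBy.nsmul t
    rwa [two_nsmul] at this
  refine eq_zero_of_h1Eval_eq_zero_of_three_of_comm W _ (smul_fixed_eq_zero_two_pow W hzfix M)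
    (fun g ↦ ?_) hx
  let zA : geomTorsion W ((2 : ℕ) : ℤ) ≃+ geomTorsion W ((2 : ℕ) : ℤ) :=
    DistribMulAction.toAddEquiv _ z
  let σA : geomTorsion W ((2 : ℕ) : ℤ) ≃+ geomTorsion W ((2 : ℕ) : ℤ) :=
    DistribMulAction.toAddEquiv _ (g⁻¹ * z * g)
  have hzA : ∀ t, zA t = z • t := fun _ ↦ rfl
  have hσA : ∀ t, σA t = (g⁻¹ * z * g) • t := fun _ ↦ rfl
  have hσfix : ∀ t, σA t = t → t = 0 := fun t ht ↦ by
    rw [hσA, mul_smul, mul_smul] at ht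
    have h' : z • g • t = g • t := by
      have := congrArg (g • ·) ht
      simpa only [smul_inv_smul] using this
    have hg0 : g • t = 0 := hzfix _ h'
    have := congrArg (g⁻¹ • ·) hg0
    simpa only [inv_smul_smul, smul_zero] using this
  rcases eq_or_eq_sq_of_fixedPointFree h2 hcard σA zA hσfix (fun t ht ↦ hzfix t ht) with h | h
  · -- `g⁻¹ z g = z · π` with `π ∈ Γ_{K(E[2])}`
    have hπ : z⁻¹ * (g⁻¹ * z * g) ∈ torsionFixing W ((2 : ℕ) : ℤ) :=
      (mem_torsionFixing_iff W _).mpr fun t ↦ by rw [mul_smul, ← hσA, h t, hzA, inv_smul_smul]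
    refine ⟨z⁻¹ * (g⁻¹ * z * g), hcomm _ hπ, Or.inl fun P ↦ ?_⟩
    rw [← mul_smul, show z * (z⁻¹ * (g⁻¹ * z * g)) = g⁻¹ * z * g by group]
  · -- `g⁻¹ z g = z² · π` with `π ∈ Γ_{K(E[2])}`
    have hπ : (z * z)⁻¹ * (g⁻¹ * z * g) ∈ torsionFixing W ((2 : ℕ) : ℤ) :=
      (mem_torsionFixing_iff W _).mpr fun t ↦ by
        rw [mul_smul, ← hσA, h t, hzA, hzA, ← mul_smul z z t, inv_smul_smul]
    refine ⟨(z * z)⁻¹ * (g⁻¹ * z * g), hcomm _ hπ, Or.inr fun P ↦ ?_⟩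
    rw [← mul_smul, ← mul_smul,
      show z * z * ((z * z)⁻¹ * (g⁻¹ * z * g)) = g⁻¹ * z * g by group]

end Cohomology

/-! ## §3 `W/ℚ`, `[K:ℚ] = 2`, `ρ̄_{W,2}` onto: Prop. 9.1 and McCallum's (2) at level `2^M` -/

section Rational

variable (W : WeierstrassCurve ℚ) [W.IsElliptic] (K : Type) [Field K] [NumberField K]

/-- `E(K̄)[2^M]` is finite (it has `4^M` elements). [cite: SilvermanAEC2009, Cor. III.6.4(b)] -/
theorem finite_geomTorsion_two_pow (M : ℕ) :
    Finite (geomTorsion (W.baseChange K) ((2 ^ M : ℕ) : ℤ)) := by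
  haveI : (W.baseChange K).IsElliptic := by rw [baseChange]; infer_instance
  have h : Nat.card (geomTorsion (W.baseChange K) ((2 ^ M : ℕ) : ℤ)) = (2 ^ M) ^ 2 :=
    card_torsionPoints_eq_sq_holds (W.baseChange K) (AlgebraicClosure K) (n := 2 ^ M)
      (by exact_mod_cast pow_ne_zero M two_ne_zero)
  exact Nat.finite_of_card_ne_zero (by rw [h]; positivity)

/-- **GROSS'S PROP. 9.1 AT `p = 2`, LEVEL `2^M`: restriction `H¹(K, E[2^M]) → Hom(Γ_{K(E[2^M])}, E[2^M])`
is injective**, for `W/ℚ` elliptic and any number field `K`, GIVEN `z ∈ Γ_K` without non-zero fixed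
point on `E[2]` which commutes on `E[2^M]` with `Γ_{K(E[2])}` (hypothesis `hcomm`, see the module
docstring: automatic on CM curves with `2` inert, where `Γ_{ℚ(E[2])} ⊆ Γ_F` acts through
`(O ⊗ ℤ₂)ˣ`; for `[K:ℚ] = 2` and `ρ̄_{W,2}` onto such `z` mod `E[2]` exists,
`exists_smul_three_of_hasSurjectiveModNGaloisRep`). Equivalently `H¹(Gal(K(E[2^M])/K), E[2^M]) = 0`.
[cite: GrossLMS1991, §9 Prop. 9.1] [cite: McCallumLMS1991, §3 (2)] [cite: LawsonWuthrich2016, Lemma 6] -/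
theorem h1_restriction_injective_two_pow {M : ℕ} {z : absoluteGaloisGroup K}
    (hzfix : ∀ P : geomTorsion (W.baseChange K) ((2 : ℕ) : ℤ), z • P = P → P = 0)
    (hcomm : ∀ π ∈ torsionFixing (W.baseChange K) ((2 : ℕ) : ℤ),
      ∀ P : geomTorsion (W.baseChange K) ((2 ^ M : ℕ) : ℤ), π • z • P = z • π • P)
    {x : galH1Torsion (W.baseChange K) ((2 ^ M : ℕ) : ℤ)}
    (hx : ∀ ρ ∈ torsionFixing (W.baseChange K) ((2 ^ M : ℕ) : ℤ),
      h1Eval (W.baseChange K) ((2 ^ M : ℕ) : ℤ) x ρ = 0) : x = 0 := by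
  haveI := finite_geomTorsion_two_pow W K M
  exact eq_zero_of_h1Eval_eq_zero_two_pow_of_comm (W.baseChange K) (natCard_geomTorsion_two W K)
    hzfix hcomm hx

/-- **McCALLUM'S (2) / GROSS'S PROP. 9.3 AT `p = 2`, LEVEL `2^M`: the evaluations at independent
classes of `H¹(K, E[2^M])` are jointly surjective onto `∏ E[2^M][2^{eᵢ}]`.** For `W/ℚ` with
`ρ̄_{W,2}` onto, `[K:ℚ] = 2`, `Δ_W ∉ K²`, and `z`, `hcomm` as in `h1_restriction_injective_two_pow`:
if `x_i ∈ H¹(K, E[2^M])` are killed by `2^{eᵢ}` and independent (`∑ aᵢxᵢ = 0 ⟹ 2^{eᵢ} ∣ aᵢ`), then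
every `t ∈ ∏ E[2^M][2^{eᵢ}]` is `([x_i, ρ])_i` for some `ρ ∈ Γ_{K(E[2^M])}`. The tree's
`KolyvaginPairing.eq_piTors_of_stable_of_indep` (simple bottom layer `E[2]` with scalar commutant:
g3's `eq_bot_or_eq_top_two_of_hasSurjectiveModNGaloisRep`, `eq_zero_or_eq_id_of_commute_two_…` with a
transposition from `Δ_W ∉ K²`), the independence of the coordinate functionals coming from the
level-`2^M` injectivity. [cite: McCallumLMS1991, §3 (2)] [cite: GrossLMS1991, Prop. 9.3] -/
theorem exists_h1Eval_eq_two_pow (hK2 : Module.finrank ℚ K = 2)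
    (hsurj : W.HasSurjectiveModNGaloisRep 2) (hΔK : ¬ IsSquare (W.baseChange K).Δ) {M : ℕ} (hM : 1 ≤ M)
    {z : absoluteGaloisGroup K}
    (hzfix : ∀ P : geomTorsion (W.baseChange K) ((2 : ℕ) : ℤ), z • P = P → P = 0)
    (hcomm : ∀ π ∈ torsionFixing (W.baseChange K) ((2 : ℕ) : ℤ),
      ∀ P : geomTorsion (W.baseChange K) ((2 ^ M : ℕ) : ℤ), π • z • P = z • π • P)
    {ι : Type*} [Fintype ι] (xs : ι → galH1Torsion (W.baseChange K) ((2 ^ M : ℕ) : ℤ)) (e : ι → ℕ)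
    (he : ∀ i, (((2 : ℕ) : ℤ) ^ e i) • xs i = 0)
    (hind : ∀ a : ι → ℤ, ∑ i, a i • xs i = 0 → ∀ i, (((2 : ℕ) : ℤ) ^ e i) ∣ a i)
    (t : ι → geomTorsion (W.baseChange K) ((2 ^ M : ℕ) : ℤ))
    (ht : ∀ i, (((2 : ℕ) : ℤ) ^ e i) • t i = 0) :
    ∃ ρ ∈ torsionFixing (W.baseChange K) ((2 ^ M : ℕ) : ℤ),
      ∀ i, h1Eval (W.baseChange K) ((2 ^ M : ℕ) : ℤ) (xs i) ρ = t i := by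
  haveI : (W.baseChange K).IsElliptic := by rw [baseChange]; infer_instance
  -- simplicity and scalar commutant of the `Γ_K`-module `E(K̄)[2]`
  have hS := eq_bot_or_eq_top_two_of_hasSurjectiveModNGaloisRep W K hK2 hsurj
  obtain ⟨τ, u, w, hu0, hu, hw⟩ := exists_transposition_of_not_isSquare_Δ (W.baseChange K) hΔK
  have hC : ∀ f : geomTorsion (W.baseChange K) ((2 : ℕ) : ℤ) →+ geomTorsion (W.baseChange K) ((2 : ℕ) : ℤ),
      (∀ (g : absoluteGaloisGroup K) (s : geomTorsion (W.baseChange K) ((2 : ℕ) : ℤ)),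
        f (g • s) = g • f s) → ∃ k : ℤ, ∀ s, f s = k • s := by
    intro f hf
    rcases eq_zero_or_eq_id_of_commute_two_of_hasSurjectiveModNGaloisRep W K hK2 hsurj hu hu0 hw f hf
      with h | h
    · exact ⟨0, fun s ↦ by rw [h s, zero_smul]⟩
    · exact ⟨1, fun s ↦ by rw [h s, one_smul]⟩
  -- the bottom layer `E[2] ⊆ E[2^M]`
  have hdvd : ((2 : ℕ) : ℤ) ∣ ((2 ^ M : ℕ) : ℤ) :=
    Int.natCast_dvd_natCast.mpr (dvd_pow_self 2 (Nat.one_le_iff_ne_zero.mp hM))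
  set ι₁ : geomTorsion (W.baseChange K) ((2 : ℕ) : ℤ) →+ geomTorsion (W.baseChange K) ((2 ^ M : ℕ) : ℤ) :=
    AddSubgroup.inclusion ((W.baseChange K).geomTorsion_le_of_dvd hdvd) with hι₁
  have hιG : ∀ (g : absoluteGaloisGroup K) (s : geomTorsion (W.baseChange K) ((2 : ℕ) : ℤ)),
      ι₁ (g • s) = g • ι₁ s := fun _ _ ↦ rfl
  have hrange : ∀ s : geomTorsion (W.baseChange K) ((2 ^ M : ℕ) : ℤ), ((2 : ℕ) : ℤ) • s = 0 →
      ∃ s₁, ι₁ s₁ = s := fun s hs ↦ by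
    refine ⟨⟨(s : geomPoints (W.baseChange K)), ?_⟩, rfl⟩
    rw [mem_geomTorsion_iff, ← AddSubgroupClass.coe_zsmul, hs]
    rfl
  have hfull := KolyvaginPairing.eq_piTors_of_stable_of_indep Nat.prime_two hS hC ι₁ hιG hrange
    (Finset.univ.sup e) (fun i ↦ Finset.le_sup (Finset.mem_univ i))
    (jointRangeN (W.baseChange K) ((2 ^ M : ℕ) : ℤ) xs)
    (fun g m hm ↦ smul_mem_jointRangeN (W.baseChange K) _ xs g hm) (fun m hm i ↦ ?_) (fun a ha ↦ ?_)
  · have : t ∈ jointRangeN (W.baseChange K) ((2 ^ M : ℕ) : ℤ) xs := by rw [hfull]; exact ht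
    exact this
  · obtain ⟨ρ, hρ, hm⟩ := hm
    rw [← hm i, ← h1Eval_zsmul (W.baseChange K) _ _ _ hρ, he i, h1Eval_zero (W.baseChange K) _ hρ]
  · refine hind a (h1_restriction_injective_two_pow W K hzfix hcomm fun ρ hρ ↦ ?_)
    rw [h1Eval_sum (W.baseChange K) _ _ _ hρ]
    simp only [h1Eval_zsmul (W.baseChange K) _ _ _ hρ]
    exact ha _ ⟨ρ, hρ, fun i ↦ rfl⟩

end Rational

end Summit.BirchSwinnertonDyer.BirchSwinnertonDyer.Theorems.KolyvaginImageTwo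

end
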